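import Summits.Ventures.PackingBounds.ThreePointCert.Sound

/-!
# Soundness of the general-dimension three-point certificate checker, II: the checks

Framing: lottery ticket; floor = certified bounds/negative ranges. Venture `PackingBounds`
(cell `pub-packcert`), three-point SDP family.

Second half of the soundness of `ThreePointCert.Check` (first half: `ThreePointCert.Sound`, the
values of the reflected polynomials): validity predicates for the expansion data
(`FexpValidG`, composable row-chunk validity `ChunkVal`/`RValid` so that a Gram expansion can be
kernel-validated in any number of chunks, `PolysOK3`), soundness of the two polynomial checks
(`FII3_of_check`, `AF3_of_check`), of the side and bound checks, and the final theorem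
`card_le_of_cert3`: a fully checked certificate `c` bounds every finite set of unit vectors of
`ℝ^{c.n}` with pairwise inner products `≤ c.p/c.q` by `c.N` — Bachoc–Vallentin's Theorem 4.2 via
`Literature.Geometry.DiscreteGeometry.BachocVallentin.card_le_of_threePoint` (all `n ≥ 4`).

## References
* C. Bachoc, F. Vallentin, J. Amer. Math. Soc. 21 (2008), Theorem 4.2. [`BachocVallentin2007`]
-/

noncomputable section

open Finset
open scoped RealInnerProductSpace

namespace Summit.Ventures.PackingBounds.ThreePointCert

open Literature.Geometry.DiscreteGeometry Literature.Geometry.DiscreteGeometry.PolyCert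
open Literature.Geometry.DiscreteGeometry.PolyCert.SPoly
open Literature.Analysis.SpecialFunctions

/-! ### Validity of the expansion data -/

/-- Semantic validity of an `FI` expansion: `FP = FPolyG` on the unit box. -/
def FexpValidG (c : Cert3) (FP : SPoly) : Prop :=
  ∀ u v t : ℝ, |u| ≤ 1 → |v| ≤ 1 → |t| ≤ 1 → eval FP u v t = eval (FPolyG c.n c.d c.F) u v t

/-- `FexpOKG` implies validity. -/
theorem fexpValidG_of_ok (c : Cert3) (FP : SPoly) (h : FexpOKG c FP = true) : FexpValidG c FP :=
  fun u v t hu hv ht => (eval_eq_of_residual0 _ _ h u v t hu hv ht).symm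

/-- `FPolyG` is additive in the block list (on values). -/
theorem eval_FPolyG_append (n d : ℕ) (l₁ l₂ : List FBlk) (u v t : ℝ) :
    eval (FPolyG n d (l₁ ++ l₂)) u v t = eval (FPolyG n d l₁) u v t + eval (FPolyG n d l₂) u v t := by
  simp [FPolyG, eval_mergeAll, List.map_append, List.sum_append]

/-- Soundness of a block-chunk check. -/
theorem eval_of_FchunkOKG (n d : ℕ) (bs : List FBlk) (Dprev Dnext : SPoly)
    (h : FchunkOKG n d bs Dprev Dnext = true) (u v t : ℝ) (hu : |u| ≤ 1) (hv : |v| ≤ 1) (ht : |t| ≤ 1) :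
    eval Dnext u v t = eval Dprev u v t + eval (FPolyG n d bs) u v t := by
  have h0 := abs_eval_le_of_residualBound _ _ h hu hv ht
  rw [eval_append, eval_append, eval_neg] at h0
  have h1 : |Dprev.eval u v t + (FPolyG n d bs).eval u v t + -Dnext.eval u v t| ≤ 0 := by simpa using h0
  have h2 := abs_nonpos_iff.1 h1
  linarith

/-- Validity of an `FI` expansion from three block chunks. -/
theorem fexpValidG_of_chunks (c : Cert3) (FP D1 D2 : SPoly) (n1 n2 : ℕ)
    (h1 : FchunkOKG c.n c.d (c.F.take n1) [] D1 = true)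
    (h2 : FchunkOKG c.n c.d ((c.F.drop n1).take n2) D1 D2 = true)
    (h3 : FchunkOKG c.n c.d ((c.F.drop n1).drop n2) D2 FP = true) : FexpValidG c FP := by
  intro u v t hu hv ht
  have e1 := eval_of_FchunkOKG _ _ _ _ _ h1 u v t hu hv ht
  have e2 := eval_of_FchunkOKG _ _ _ _ _ h2 u v t hu hv ht
  have e3 := eval_of_FchunkOKG _ _ _ _ _ h3 u v t hu hv ht
  rw [eval_nil, zero_add] at e1
  have f1 : eval (FPolyG c.n c.d c.F) u v t =
      eval (FPolyG c.n c.d (c.F.take n1)) u v t + eval (FPolyG c.n c.d (c.F.drop n1)) u v t := by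
    rw [← eval_FPolyG_append, List.take_append_drop]
  have f2 : eval (FPolyG c.n c.d (c.F.drop n1)) u v t =
      eval (FPolyG c.n c.d ((c.F.drop n1).take n2)) u v t +
        eval (FPolyG c.n c.d ((c.F.drop n1).drop n2)) u v t := by
    rw [← eval_FPolyG_append, List.take_append_drop]
  rw [e3, e2, e1, f1, f2]; ring

/-- Block-chunk validity of the `FI` expansion on values: `Dnext = Dprev + FPolyG bs` on the unit
box (the semantic content of `FchunkOKG`, composable over any number of chunks). -/
def FChunkVal (c : Cert3) (bs : List FBlk) (Dprev Dnext : SPoly) : Prop :=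
  ∀ u v t : ℝ, |u| ≤ 1 → |v| ≤ 1 → |t| ≤ 1 →
    eval Dnext u v t = eval Dprev u v t + eval (FPolyG c.n c.d bs) u v t

/-- A kernel block-chunk check gives chunk validity. -/
theorem fchunkVal_of_ok (c : Cert3) (bs : List FBlk) (Dprev Dnext : SPoly)
    (h : FchunkOKG c.n c.d bs Dprev Dnext = true) : FChunkVal c bs Dprev Dnext :=
  fun u v t hu hv ht => eval_of_FchunkOKG c.n c.d bs Dprev Dnext h u v t hu hv ht

/-- Consecutive block chunks compose. -/
theorem fchunkVal_append (c : Cert3) (l₁ l₂ : List FBlk) (D0 D1 D2 : SPoly)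
    (h1 : FChunkVal c l₁ D0 D1) (h2 : FChunkVal c l₂ D1 D2) : FChunkVal c (l₁ ++ l₂) D0 D2 := by
  intro u v t hu hv ht
  rw [h2 u v t hu hv ht, h1 u v t hu hv ht, eval_FPolyG_append]; ring

/-- Validity of the `FI` expansion from a full-range block-chunk validity. -/
theorem fexpValidG_of_fchunkVal (c : Cert3) (FP : SPoly) (bs : List FBlk) (hbs : bs = c.F)
    (h : FChunkVal c bs [] FP) : FexpValidG c FP := by
  intro u v t hu hv ht
  rw [h u v t hu hv ht, eval_nil, zero_add, hbs]

/-- Row-chunk validity on values: rows `[i0, i0+cnt)` of the Gram form `zᵀ(LLᵀ)z` of `g`, added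
to `Dprev`, give `Dnext` on the unit box (the semantic content of `chunkOK`, composable over any
number of chunks). -/
def ChunkVal (g : GramBlk) (i0 cnt : ℕ) (Dprev Dnext : SPoly) : Prop :=
  g.lenOK = true ∧ i0 + cnt ≤ g.z.length ∧ ∀ u v t : ℝ, |u| ≤ 1 → |v| ≤ 1 → |t| ≤ 1 →
    eval Dnext u v t = eval Dprev u v t + ∑ i ∈ Finset.Ico i0 (i0 + cnt), rowVal g u v t i

/-- A kernel chunk check gives chunk validity. -/
theorem chunkVal_of_ok (g : GramBlk) (i0 cnt : ℕ) (Dprev Dnext : SPoly)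
    (h : chunkOK g i0 cnt Dprev Dnext = true) : ChunkVal g i0 cnt Dprev Dnext := by
  have h' := h
  simp only [chunkOK, Bool.and_eq_true, decide_eq_true_eq] at h'
  exact ⟨h'.1.1, h'.1.2, fun u v t hu hv ht => eval_of_chunkOK g i0 cnt Dprev Dnext h u v t hu hv ht⟩

/-- Consecutive chunks compose. -/
theorem chunkVal_trans (g : GramBlk) (i0 c1 c2 : ℕ) (D0 D1 D2 : SPoly)
    (h1 : ChunkVal g i0 c1 D0 D1) (h2 : ChunkVal g (i0 + c1) c2 D1 D2) :
    ChunkVal g i0 (c1 + c2) D0 D2 := by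
  refine ⟨h1.1, by have := h2.2.1; omega, fun u v t hu hv ht => ?_⟩
  rw [h2.2.2 u v t hu hv ht, h1.2.2 u v t hu hv ht, add_assoc, ← add_assoc i0,
    Finset.sum_Ico_consecutive _ (Nat.le_add_right i0 c1) (by omega)]

/-- Full-range chunk validity: `R = zᵀ(LLᵀ)z ≥ 0` on the unit box. -/
def RValid (g : GramBlk) (R : SPoly) : Prop := ChunkVal g 0 g.z.length [] R

/-- A validated Gram expansion is nonnegative on the box. -/
theorem eval_nonneg_of_rvalid (g : GramBlk) (R : SPoly) (h : RValid g R) (u v t : ℝ)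
    (hu : |u| ≤ 1) (hv : |v| ≤ 1) (ht : |t| ≤ 1) : 0 ≤ eval R u v t := by
  have e := h.2.2 u v t hu hv ht
  rw [eval_nil, zero_add, Nat.zero_add, ← Finset.range_eq_Ico, ← eval_quadL_eq_sum_rowVal g h.1] at e
  rw [e]; exact eval_quadL_nonneg g h.1 u v t

/-- `RValid` from a single chunk check. -/
theorem rvalid_of_single (g : GramBlk) (R : SPoly) (h : chunkOK g 0 g.z.length [] R = true) :
    RValid g R := chunkVal_of_ok g 0 g.z.length [] R h

/-- Validity of all expansion data of a certificate: the `FI` expansion and the seven Gram blocks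
(`E0 … E4` for `(ii')`, `EQ0, EQ1` for `(i')`). -/
structure PolysOK3 (c : Cert3) (P : CertPolys3) (g0 g1 g2 g3 g4 q0 q1 : GramBlk) : Prop where
  /-- `FI` expansion valid -/
  hF : FexpValidG c P.FP
  /-- Gram expansion for multiplier `1` of `(ii')` -/
  h0 : RValid g0 P.E0
  /-- Gram expansion for multiplier `m₁` -/
  h1 : RValid g1 P.E1
  /-- Gram expansion for multiplier `m₂` -/
  h2 : RValid g2 P.E2
  /-- Gram expansion for multiplier `m₃` -/
  h3 : RValid g3 P.E3
  /-- Gram expansion for multiplier `s₄` -/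
  h4 : RValid g4 P.E4
  /-- Gram expansion for multiplier `1` of `(i')` -/
  hq0 : RValid q0 P.EQ0
  /-- Gram expansion for multiplier `g_q(u)` of `(i')` -/
  hq1 : RValid q1 P.EQ1

/-- Unpacked side conditions. -/
theorem side_of_check (c : Cert3) (hs : checkSide3 c = true) :
    4 ≤ c.n ∧ 0 < c.q ∧ c.p ≤ (c.q : ℤ) ∧ -(c.q : ℤ) ≤ c.p ∧ c.A.length = c.d + 1 ∧
      (∀ b ∈ c.F, b.k ≤ c.d) ∧ c.B12 * c.B12 ≤ (c.B11 : ℤ) * (c.B22 : ℤ) := by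
  simp only [checkSide3, Bool.and_eq_true, decide_eq_true_eq, List.all_eq_true] at hs
  obtain ⟨⟨⟨⟨⟨⟨h1, h2⟩, h3⟩, h4⟩, h5⟩, h6⟩, h7⟩ := hs
  exact ⟨h1, h2, h3, h4, h5, h6, h7⟩

/-- On the box `[-1, p/q]` with `p ≤ q`: `|u| ≤ 1`. -/
theorem abs_le_one_of_box (p : ℤ) (q : ℕ) (hq : 0 < q) (hpq : p ≤ (q : ℤ)) (u : ℝ)
    (hu : -1 ≤ u) (hu' : u ≤ (p : ℝ) / q) : |u| ≤ 1 := by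
  have hq' : (0 : ℝ) < q := by exact_mod_cast hq
  have hpq' : (p : ℝ) ≤ q := by exact_mod_cast hpq
  have : (p : ℝ) / q ≤ 1 := by rw [div_le_one hq']; exact hpq'
  exact abs_le.2 ⟨hu, by linarith⟩

/-- On the box: `q u ≤ p`. -/
theorem qmul_le_of_box (p : ℤ) (q : ℕ) (hq : 0 < q) (u : ℝ) (hu' : u ≤ (p : ℝ) / q) :
    (q : ℝ) * u ≤ p := by
  have hq' : (0 : ℝ) < q := by exact_mod_cast hq
  have := mul_le_mul_of_nonneg_left hu' hq'.le
  rwa [mul_div_cancel₀ _ hq'.ne'] at this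

set_option maxHeartbeats 4000000 in
/-- Soundness of `(ii')`: on `D'`, `F ≤ -b₂₂` (in units: `FvalG/D² ≤ -B22/(D²W)`). -/
theorem FII3_of_check (c : Cert3) (P : CertPolys3) {g0 g1 g2 g3 g4 q0 q1 : GramBlk}
    (hP : PolysOK3 c P g0 g1 g2 g3 g4 q0 q1) (h : checkII3 c P = true) (hs : checkSide3 c = true)
    (u v t : ℝ)
    (hu : -1 ≤ u) (hu' : u ≤ (c.p : ℝ) / c.q) (hv : -1 ≤ v) (hv' : v ≤ (c.p : ℝ) / c.q)
    (ht : -1 ≤ t) (ht' : t ≤ (c.p : ℝ) / c.q)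
    (hp : 0 ≤ 1 + 2 * u * v * t - u ^ 2 - v ^ 2 - t ^ 2) :
    FvalG c.n c.F u v t / 2 ^ (2 * c.S) ≤ -((c.B22 : ℝ) / c.DDW) := by
  obtain ⟨hn, hq, hpq, _, hAlen, hFk, _⟩ := side_of_check c hs
  have hu1 := abs_le_one_of_box c.p c.q hq hpq u hu hu'
  have hv1 := abs_le_one_of_box c.p c.q hq hpq v hv hv'
  have ht1 := abs_le_one_of_box c.p c.q hq hpq t ht ht'
  have gu := gq_nonneg c.p c.q u hu (qmul_le_of_box c.p c.q hq u hu')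
  have gv := gq_nonneg c.p c.q v hv (qmul_le_of_box c.p c.q hq v hv')
  have gt := gq_nonneg c.p c.q t ht (qmul_le_of_box c.p c.q hq t ht')
  have hres := abs_eval_le_of_residualBound _ _ h hu1 hv1 ht1
  rw [eval_mergeAll] at hres
  simp only [List.map_cons, List.map_nil, List.sum_cons, List.sum_nil, add_zero, eval_neg, eval_C,
    Int.cast_natCast] at hres
  have hrhs : 0 ≤ eval (rhsII3 c P) u v t := by
    have e0 := eval_nonneg_of_rvalid g0 P.E0 hP.h0 u v t hu1 hv1 ht1
    have e1 := eval_nonneg_of_rvalid g1 P.E1 hP.h1 u v t hu1 hv1 ht1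
    have e2 := eval_nonneg_of_rvalid g2 P.E2 hP.h2 u v t hu1 hv1 ht1
    have e3 := eval_nonneg_of_rvalid g3 P.E3 hP.h3 u v t hu1 hv1 ht1
    have e4 := eval_nonneg_of_rvalid g4 P.E4 hP.h4 u v t hu1 hv1 ht1
    rw [rhsII3, eval_mergeAll]
    simp only [List.map_cons, List.map_nil, List.sum_cons, List.sum_nil, add_zero, eval_mulN,
      eval_m1P, eval_m2P, eval_m3P, eval_p4]
    generalize eval P.E0 u v t = r0 at *
    generalize eval P.E1 u v t = r1 at *
    generalize eval P.E2 u v t = r2 at *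
    generalize eval P.E3 u v t = r3 at *
    generalize eval P.E4 u v t = r4 at *
    generalize (u + 1) * ((c.p : ℝ) - c.q * u) = a1 at *
    generalize (v + 1) * ((c.p : ℝ) - c.q * v) = a2 at *
    generalize (t + 1) * ((c.p : ℝ) - c.q * t) = a3 at *
    have m12 := mul_nonneg gu gv
    have m13 := mul_nonneg gu gt
    have m23 := mul_nonneg gv gt
    have m123 := mul_nonneg gu (mul_nonneg gv gt)
    nlinarith [mul_nonneg gu e1, mul_nonneg gv e1, mul_nonneg gt e1, mul_nonneg m12 e2,
      mul_nonneg m13 e2, mul_nonneg m23 e2, mul_nonneg m123 e3, mul_nonneg hp e4]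
  generalize hR : eval (rhsII3 c P) u v t = R at hres hrhs
  have htgt : 0 ≤ eval (targetII3 c P) u v t := by
    have h1 := (abs_le.1 hres).1
    linarith
  rw [targetII3, eval_neg, eval_append, eval_C, hP.hF u v t hu1 hv1 ht1,
    eval_FPolyG c.n c.d c.F hFk] at htgt
  push_cast at htgt
  have hW : (0 : ℝ) < Wfac c.d := by exact_mod_cast Wfac_pos c.d
  have hD : (0 : ℝ) < 2 ^ (2 * c.S) := pow_pos (by norm_num) _
  have hDDW : (c.DDW : ℝ) = 2 ^ (2 * c.S) * (Wfac c.d : ℝ) := by simp [Cert3.DDW]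
  have key : FvalG c.n c.F u v t * (Wfac c.d : ℝ) ≤ -(c.B22 : ℝ) := by linarith
  rw [hDDW, div_le_iff₀ hD]
  have e : -((c.B22 : ℝ) / (2 ^ (2 * c.S) * Wfac c.d)) * 2 ^ (2 * c.S) = -(c.B22 : ℝ) / Wfac c.d := by
    field_simp
  rw [e, le_div_iff₀ hW]
  exact key

set_option maxHeartbeats 4000000 in
/-- Soundness of `(i')`: on `[-1, s]`, `A(u) + 3F(u,u,1) ≤ -1 - 2b₁₂ - b₂₂` (in units). -/
theorem AF3_of_check (c : Cert3) (P : CertPolys3) {g0 g1 g2 g3 g4 q0 q1 : GramBlk}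
    (hP : PolysOK3 c P g0 g1 g2 g3 g4 q0 q1) (h : checkI3 c P = true) (hs : checkSide3 c = true)
    (u : ℝ) (hu : -1 ≤ u) (hu' : u ≤ (c.p : ℝ) / c.q) :
    AvalG c.n c.A u / 2 ^ (2 * c.S) + 3 * (FvalG c.n c.F u u 1 / 2 ^ (2 * c.S)) ≤
      -1 - 2 * ((c.B12 : ℝ) / c.DDW) - (c.B22 : ℝ) / c.DDW := by
  obtain ⟨hn, hq, hpq, _, hAlen, hFk, _⟩ := side_of_check c hs
  have hu1 := abs_le_one_of_box c.p c.q hq hpq u hu hu'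
  have h01 : |(0 : ℝ)| ≤ 1 := by norm_num
  have h11 : |(1 : ℝ)| ≤ 1 := by norm_num
  have gu := gq_nonneg c.p c.q u hu (qmul_le_of_box c.p c.q hq u hu')
  have hres := abs_eval_le_of_residualBound _ _ h hu1 h01 h01
  rw [eval_mergeAll] at hres
  simp only [List.map_cons, List.map_nil, List.sum_cons, List.sum_nil, add_zero, eval_neg, eval_C,
    Int.cast_natCast] at hres
  have hrhs : 0 ≤ eval (rhsI3 c P) u 0 0 := by
    have e0 := eval_nonneg_of_rvalid q0 P.EQ0 hP.hq0 u 0 0 hu1 h01 h01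
    have e1 := eval_nonneg_of_rvalid q1 P.EQ1 hP.hq1 u 0 0 hu1 h01 h01
    rw [rhsI3, eval_mergeAll]
    simp only [List.map_cons, List.map_nil, List.sum_cons, List.sum_nil, add_zero, eval_mulN,
      eval_gqU]
    nlinarith [mul_nonneg gu e1]
  generalize hR : eval (rhsI3 c P) u 0 0 = R at hres hrhs
  have htgt : 0 ≤ eval (targetI3 c P) u 0 0 := by
    have h1 := (abs_le.1 hres).1
    linarith
  have hFss : eval (substUU1 P.FP) u 0 0 = (Wfac c.d : ℝ) * FvalG c.n c.F u u 1 := by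
    rw [eval_substUU1, hP.hF u u 1 hu1 hu1 h11, eval_FPolyG c.n c.d c.F hFk]
  rw [targetI3, eval_neg, eval_append, eval_append, eval_C, eval_smul, hFss,
    eval_APolyG c.n c.d c.A hAlen.le] at htgt
  push_cast at htgt
  have hW : (0 : ℝ) < Wfac c.d := by exact_mod_cast Wfac_pos c.d
  have hD : (0 : ℝ) < 2 ^ (2 * c.S) := pow_pos (by norm_num) _
  have hDDW : (c.DDW : ℝ) = 2 ^ (2 * c.S) * (Wfac c.d : ℝ) := by simp [Cert3.DDW]
  rw [hDDW] at htgt ⊢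
  have hDW : (0 : ℝ) < 2 ^ (2 * c.S) * (Wfac c.d : ℝ) := mul_pos hD hW
  generalize hAv : AvalG c.n c.A u = AV at htgt ⊢
  generalize hFv : FvalG c.n c.F u u 1 = FV at htgt ⊢
  -- htgt : 0 ≤ -((2^(2S) W + 2 B12 + B22) + W AV + 3 (W FV))
  have key : (Wfac c.d : ℝ) * (AV + 3 * FV) ≤
      -(2 ^ (2 * c.S) * (Wfac c.d : ℝ)) - 2 * (c.B12 : ℝ) - (c.B22 : ℝ) := by linarith
  have lhs_eq : AV / 2 ^ (2 * c.S) + 3 * (FV / 2 ^ (2 * c.S)) =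
      ((Wfac c.d : ℝ) * (AV + 3 * FV)) / (2 ^ (2 * c.S) * Wfac c.d) := by
    field_simp
  have rhs_eq : -1 - 2 * ((c.B12 : ℝ) / (2 ^ (2 * c.S) * Wfac c.d)) - (c.B22 : ℝ) / (2 ^ (2 * c.S) * Wfac c.d)
      = (-(2 ^ (2 * c.S) * (Wfac c.d : ℝ)) - 2 * (c.B12 : ℝ) - (c.B22 : ℝ)) / (2 ^ (2 * c.S) * Wfac c.d) := by
    field_simp
  rw [lhs_eq, rhs_eq]
  exact div_le_div_of_nonneg_right key hDW.le

/-- The `b`-matrix is positive semidefinite as a quadratic. -/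
theorem bquad3_nonneg_of_check (c : Cert3) (hs : checkSide3 c = true) (l : ℝ) :
    0 ≤ (c.B11 : ℝ) / c.DDW + 2 * ((c.B12 : ℝ) / c.DDW) * l + (c.B22 : ℝ) / c.DDW * l ^ 2 := by
  obtain ⟨_, _, _, _, _, _, hdet⟩ := side_of_check c hs
  have hdet' : (c.B12 : ℝ) * c.B12 ≤ (c.B11 : ℝ) * c.B22 := by exact_mod_cast hdet
  have hDDW : (0 : ℝ) < c.DDW := by
    have : 0 < c.DDW := by unfold Cert3.DDW; exact Nat.mul_pos (Nat.two_pow_pos _) (Wfac_pos c.d)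
    exact_mod_cast this
  refine BachocVallentin.quad_nonneg_of_psd2 _ _ _ (by positivity) (by positivity) ?_ l
  rw [div_pow, div_mul_div_comm, sq, sq]
  exact div_le_div_of_nonneg_right hdet' (by positivity)

/-- The bound is `< N + 1` and `≥ 0` when `checkBound3` succeeds. -/
theorem bound3_of_check (c : Cert3) (P : CertPolys3) (hF : FexpValidG c P.FP) (hs : checkSide3 c = true)
    (h : checkBound3 c P = true) :
    1 + AvalG c.n c.A 1 / 2 ^ (2 * c.S) + (c.B11 : ℝ) / c.DDW + FvalG c.n c.F 1 1 1 / 2 ^ (2 * c.S)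
        < (c.N : ℝ) + 1 ∧
      0 ≤ 1 + AvalG c.n c.A 1 / 2 ^ (2 * c.S) + (c.B11 : ℝ) / c.DDW + FvalG c.n c.F 1 1 1 / 2 ^ (2 * c.S) := by
  obtain ⟨hn, hq, hpq, _, hAlen, hFk, _⟩ := side_of_check c hs
  simp only [checkBound3, Bool.and_eq_true, decide_eq_true_eq] at h
  obtain ⟨hlt, hge⟩ := h
  have h11 : |(1 : ℝ)| ≤ 1 := by norm_num
  have hAv : (coeffSum (APolyG c.n c.d c.A) : ℝ) = (Wfac c.d : ℝ) * AvalG c.n c.A 1 := by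
    rw [← eval_one_one_one, eval_APolyG c.n c.d c.A hAlen.le]
  have hFv : (coeffSum P.FP : ℝ) = (Wfac c.d : ℝ) * FvalG c.n c.F 1 1 1 := by
    rw [← eval_one_one_one, hF 1 1 1 h11 h11 h11, eval_FPolyG c.n c.d c.F hFk]
  have hlt' : ((c.DDW : ℝ) + (coeffSum (APolyG c.n c.d c.A) : ℝ) + c.B11 + (coeffSum P.FP : ℝ))
      < ((c.N : ℝ) + 1) * c.DDW := by exact_mod_cast hlt
  have hge' : (0 : ℝ) ≤ (c.DDW : ℝ) + (coeffSum (APolyG c.n c.d c.A) : ℝ) + c.B11 + (coeffSum P.FP : ℝ) := by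
    exact_mod_cast hge
  rw [hAv, hFv] at hlt' hge'
  have hW : (0 : ℝ) < Wfac c.d := by exact_mod_cast Wfac_pos c.d
  have hD : (0 : ℝ) < 2 ^ (2 * c.S) := pow_pos (by norm_num) _
  have hDDW : (c.DDW : ℝ) = 2 ^ (2 * c.S) * (Wfac c.d : ℝ) := by simp [Cert3.DDW]
  rw [hDDW] at hlt' hge' ⊢
  have hDW : (0 : ℝ) < 2 ^ (2 * c.S) * (Wfac c.d : ℝ) := mul_pos hD hW
  generalize AvalG c.n c.A 1 = AV at *
  generalize FvalG c.n c.F 1 1 1 = FV at *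
  have e : (1 : ℝ) + AV / 2 ^ (2 * c.S) + (c.B11 : ℝ) / (2 ^ (2 * c.S) * Wfac c.d) + FV / 2 ^ (2 * c.S) =
      (2 ^ (2 * c.S) * (Wfac c.d : ℝ) + Wfac c.d * AV + c.B11 + Wfac c.d * FV) / (2 ^ (2 * c.S) * Wfac c.d) := by
    field_simp
  rw [e]
  constructor
  · rw [div_lt_iff₀ hDW]; linarith
  · exact div_nonneg hge' hDW.le

/-- **The bound from a checked certificate** (Bachoc–Vallentin Theorem 4.2, any `n ≥ 4`, angle
`s = p/q`): if the side conditions, the expansions, the two polynomial checks and the numerical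
bound all pass, every finite set of unit vectors of `ℝⁿ` with pairwise inner products `≤ p/q` has
at most `N` elements. -/
theorem card_le_of_cert3 (c : Cert3) (P : CertPolys3) {g0 g1 g2 g3 g4 q0 q1 : GramBlk}
    (hP : PolysOK3 c P g0 g1 g2 g3 g4 q0 q1) (hI : checkI3 c P = true) (hII : checkII3 c P = true)
    (hs : checkSide3 c = true) (hb : checkBound3 c P = true)
    (C : Finset (EuclideanSpace ℝ (Fin c.n))) (hC : ∀ x ∈ C, ‖x‖ = 1)
    (hcode : ∀ x ∈ C, ∀ y ∈ C, x ≠ y → inner ℝ x y ≤ (c.p : ℝ) / c.q) : C.card ≤ c.N := by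
  obtain ⟨hn, hq, hpq, _, hAlen, hFk, _⟩ := side_of_check c hs
  have hbd := bound3_of_check c P hP.hF hs hb
  have hD : (0 : ℝ) < 2 ^ (2 * c.S) := pow_pos (by norm_num) _
  have hA : 0 ≤ BachocVallentin.pairSum C (fun u => AvalG c.n c.A u / 2 ^ (2 * c.S)) := by
    have h0 := pairSum_AvalG_nonneg (by omega : 3 ≤ c.n) c.A C hC
    unfold BachocVallentin.pairSum at h0 ⊢
    have e : (∑ x ∈ C, ∑ y ∈ C, AvalG c.n c.A (inner ℝ x y) / 2 ^ (2 * c.S)) =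
        (∑ x ∈ C, ∑ y ∈ C, AvalG c.n c.A (inner ℝ x y)) / 2 ^ (2 * c.S) := by
      rw [Finset.sum_div]; refine Finset.sum_congr rfl fun x _ => ?_; rw [Finset.sum_div]
    rw [e]; exact div_nonneg h0 hD.le
  have hF : 0 ≤ BachocVallentin.tripleSum C (fun u v t => FvalG c.n c.F u v t / 2 ^ (2 * c.S)) := by
    have h0 := tripleSum_FvalG_nonneg hn c.F C hC
    unfold BachocVallentin.tripleSum at h0 ⊢
    have e : (∑ x ∈ C, ∑ y ∈ C, ∑ z ∈ C,
        FvalG c.n c.F (inner ℝ x y) (inner ℝ x z) (inner ℝ y z) / 2 ^ (2 * c.S))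
        = (∑ x ∈ C, ∑ y ∈ C, ∑ z ∈ C,
          FvalG c.n c.F (inner ℝ x y) (inner ℝ x z) (inner ℝ y z)) / 2 ^ (2 * c.S) := by
      rw [Finset.sum_div]; refine Finset.sum_congr rfl fun x _ => ?_
      rw [Finset.sum_div]; refine Finset.sum_congr rfl fun y _ => ?_
      rw [Finset.sum_div]
    rw [e]; exact div_nonneg h0 hD.le
  have h := BachocVallentin.card_le_of_threePoint ((c.p : ℝ) / c.q) C hC hcode
    (fun u => AvalG c.n c.A u / 2 ^ (2 * c.S)) (fun u v t => FvalG c.n c.F u v t / 2 ^ (2 * c.S))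
    ((c.B11 : ℝ) / c.DDW) ((c.B12 : ℝ) / c.DDW) ((c.B22 : ℝ) / c.DDW) hA hF
    (fun u v t => by rw [FvalG_swap12])
    (fun u v t => by rw [FvalG_swap23])
    (bquad3_nonneg_of_check c hs)
    (fun u hu hu' => AF3_of_check c P hP hI hs u hu hu')
    (fun u v t hu hu' hv hv' ht ht' hp => FII3_of_check c P hP hII hs u v t hu hu' hv hv' ht ht' hp)
    hbd.2
  have hlt : (C.card : ℝ) < (c.N : ℝ) + 1 := lt_of_le_of_lt h hbd.1
  have hlt' : C.card < c.N + 1 := by exact_mod_cast hlt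
  omega

end Summit.Ventures.PackingBounds.ThreePointCert

end
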